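import Summits.BirchSwinnertonDyer.BirchSwinnertonDyer.Theorems.KatoDescentTamePotSupersingularJetchevIrreducibleProp47OfGross37
import Summits.BirchSwinnertonDyer.BirchSwinnertonDyer.Theorems.KatoDescentTamePotSupersingularJetchevIrreducibleProp47Adapter2
import Summits.BirchSwinnertonDyer.Rank1Residual.JET.ZhangKolyvaginPrimeGross
import HarnessLib

/-!
# Crux `WildJetchevBoundAtP` (item 19941, K9, `q = p = 3`) / shared crux `JetchevIrreducibleReadingByName` (20165):
# the GUARD of Kolyvagin's prime swap at the Kolyvagin prime `ℓ = 2` — what the K9 face (`p = 3`) needs, and what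
# the typed Gross 1991 Prop. 3.7 (2) fact already gives there

Cell `bsd-potss`, seat `bsd-potss-k9-c4` g11 (prover); `--supports stmt-BirchSwinnertonDyer-19941`, helper; route-free.
HONEST FRAMING: helper theorems only; CONDITIONAL where a named fact is displayed; nothing is booked, no item
closes, BSD is proved for no curve by any of this.

WHY. k8t-c4 g12's kernel walk `JetchevIrreducibleSwap.exists_conductor_levelIndex_ge_of_minDepth_of_irreducible`
(p556091: «level raising at minimal depth», McCallum 1991 pp. 305–306) REMOVES a prime `ℓ₀` of the start conductor
and therefore asks McCallum's Prop. 4.4 (row binder `h47row`) AT `ℓ₀`, under a guard predicate `G` with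
`hG : ∀ ℓ, Zhang–Kolyvagin ℓ → G ℓ`. Keyed on the registered S5 `stub_prop47IrredP2` (`G := (· ≠ 2)`, the boundary of
`GrossLMS1991.prop37_2_frobeniusCongruence` as typed after Nekovář 2007 Prop. 4.13 (ii)), `hG` says «2 is not a
Zhang–Kolyvagin prime for `(E, K, p)`». This file records, for the K9 face:
* §1 `eq_three_of_isKolyvaginPrime_two` — a Zhang–Kolyvagin prime `2` forces `p = 3` (`M(2) > 0 ⇒ p ∣ gcd(3, |a₂|)`);
  hence `swapGuard_of_ne_three` (`hG` for free when `p ≠ 3`: the whole K8-t′ face);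
  `not_isKolyvaginPrime_two_of_heegnerHypothesis_two` / `swapGuard_of_heegnerHypothesis_two` — `hG` for free when
  `2` SPLITS in `K`, which is EXACTLY the Heegner field the K9/KT J08 roads already choose
  (`WildUpperOptimalSharpRoadMult.…`: `hBFH W hw {2} 4`, `h2K : SatisfiesHeegnerHypothesis 2 K`); and the general
  supplier `swapGuardOnto_of` for the wider guard of §2.
* §2 `h47PG_of_prop37_2` — the S5 reading with the guard WIDENED to `l ≠ 2 ∨ ρ̄_{E,p} onto`: the typed fact's own
  second disjunct (`¬CM ∧ ∃ p odd, ρ̄_p onto ∧ every prime of the conductor Gross–Kolyvagin for p`) covers `ℓ = 2`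
  on the rows with SURJECTIVE mod-`p` image (the Elkies / 9-deficient rows of the U₀-ns node: onto mod 3, not mod 9),
  Zhang–Kolyvagin ⇒ Gross–Kolyvagin under surjectivity being the tree's `JET.ZhangGross.forall_isKolyvaginPrime_of_zhang`.
  Proof = k8t-c4 g11's `JetchevIrreducibleProp44.h47P2_of_prop37_2` (p541604) byte-for-byte except the disjunct fed to
  `prop37_2_frobeniusCongruence.reductionCongruence` (the registered `ℓ ≠ 2` form is the `Or.inl` instance).
* §3 `addOrderOf_localization_kolyvaginClass_eq_of_h47PG` — the ROW form (`h47row` of p556091 with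
  `G := fun l ↦ l ≠ 2 ∨ W.HasSurjectiveModNGaloisRep p`), = k8t-c4 g11's adapter
  `JetchevIrreducibleH63P2.addOrderOf_localization_kolyvaginClass_mul_eq_of_prop47IrredP2` with the guard widened.
NET for K9 (`p = 3`): the swap's guard is discharged on every row with `ρ̄₃` onto OR `2` not Zhang–Kolyvagin for
`(E, K, 3)` (⟸ `2 ∣ N_E`, or `2 ∣ d_K`, or `2` split in `K`, or `a₂(E) ≢ 0 (mod 3)`); the honest residue of the
walk at `p = 3` is the single row condition «`2` Zhang–Kolyvagin for `(E, K, 3)` ⇒ `ρ̄_{E,3}` onto», VOID in the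
roads' own Heegner field (2 split).

References (locators only; the one cited FACT is displayed as a hypothesis, never declared):
[cite: GrossLMS1991, §3 (3.1)–(3.3), Prop. 3.7 (2) (p. 240)] [cite: Nekovar2007, (4.3), Prop. 4.13 (ii)]
[cite: McCallumLMS1991, §4 Prop. 4.4, §5 proof of Prop. 5.2 (pp. 305–306)] [cite: Jetchev2008, Prop. 4.7, Rem. 6.2]
[cite: WZhang2014, Notations (xii)] [cite: BumpFriedbergHoffstein1990, Thm. (ii)].
Design: theorems only; `K : Type`. Axioms: `propext`, `Classical.choice`, `Quot.sound`.
-/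

set_option autoImplicit false
-- the Theorems directory repeats the summit name (sibling precedent `KatoDescentPotSupersingularAssembly.lean`)
set_option linter.dupNamespace false

noncomputable section

open scoped Classical Pointwise

open WeierstrassCurve NumberField IsDedekindDomain Field
  Literature.NumberTheory.GaloisRepresentations Literature.NumberTheory.EllipticCurves
  Literature.NumberTheory.EllipticCurves.KolyvaginCocycle Literature.NumberTheory.EllipticCurves.ModularForms
  Summit.BirchSwinnertonDyer.Rank1Residual Summit.BirchSwinnertonDyer.Rank1Residual.X11b
  Summit.BirchSwinnertonDyer.Rank1Residual.X11b.Three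
  Summit.BirchSwinnertonDyer.Rank1Residual.JET

namespace Summit.BirchSwinnertonDyer.BirchSwinnertonDyer.Theorems.JetchevIrreducibleSwapAtP

/-! ## §1 The Kolyvagin prime `2` and the swap guard -/

section Guard

variable {N : ℕ} {W : WeierstrassCurve ℚ} [W.IsGloballyMinimal] {K : Type} [Field K] [NumberField K]
  {p : ℕ}

/-- **A Zhang–Kolyvagin prime `2` forces `p = 3`**: `0 < M(2) = v_p(gcd(2 + 1, |a₂|))` gives `p ∣ 3`.
(Gross 1991 (3.3): `ℓ + 1 ≡ 0 (mod p)` at `ℓ = 2`.) [cite: GrossLMS1991, §3 (3.3)] [cite: WZhang2014, Notations (xii)] -/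
theorem eq_three_of_isKolyvaginPrime_two [Fact p.Prime] (h : Zhang2014.IsKolyvaginPrime N W K p 2) : p = 3 := by
  have hp : p.Prime := Fact.out
  have hM : 1 ≤ Zhang2014.kolyvaginIndex W p 2 := h.2.2.2.2.2
  have h3 : p ^ 1 ∣ 2 + 1 := (Zhang2014.le_kolyvaginIndex_iff.mp hM).1
  rw [pow_one] at h3
  exact (Nat.prime_dvd_prime_iff_eq hp Nat.prime_three).mp h3

/-- **The swap guard `G := (· ≠ 2)` is free when `p ≠ 3`** (the whole K8-t′ face `p ≥ 5`): no Zhang–Kolyvagin prime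
equals `2`. = the hypothesis `hG` of `JetchevIrreducibleSwap.exists_conductor_levelIndex_ge_of_minDepth_of_irreducible`
for that guard. [cite: GrossLMS1991, §3 (3.3)] -/
theorem swapGuard_of_ne_three [Fact p.Prime] (hp3 : p ≠ 3) :
    ∀ ℓ : ℕ, Zhang2014.IsKolyvaginPrime N W K p ℓ → ℓ ≠ 2 := by
  rintro ℓ hℓ rfl
  exact hp3 (eq_three_of_isKolyvaginPrime_two hℓ)

/-- If `(ℓ) ⊂ 𝓞_K` is a prime ideal (`ℓ ≠ 0`) then at most ONE prime of `𝓞_K` lies over `ℓℤ` (every prime over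
`ℓℤ` contains `ℓ`, hence equals the maximal ideal `(ℓ)`). [folklore] -/
private theorem ncard_primesOver_le_one_of_isPrime_span {ℓ : ℕ} (hℓ : (Ideal.span {(ℓ : 𝓞 K)}).IsPrime)
    (hℓ0 : ℓ ≠ 0) : ((Ideal.span {(ℓ : ℤ)}).primesOver (𝓞 K)).ncard ≤ 1 := by
  have hsub : (Ideal.span {(ℓ : ℤ)}).primesOver (𝓞 K) ⊆ {Ideal.span {(ℓ : 𝓞 K)}} := by
    intro Q hQ
    obtain ⟨hQp, hQo⟩ := hQ
    rw [Set.mem_singleton_iff]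
    have hmem : (ℓ : 𝓞 K) ∈ Q := by
      have h : (ℓ : ℤ) ∈ Q.under ℤ := by
        rw [← hQo.over]
        exact Ideal.mem_span_singleton_self _
      rw [Ideal.under_def, Ideal.mem_comap, map_natCast] at h
      exact h
    have hle : Ideal.span {(ℓ : 𝓞 K)} ≤ Q := by
      rw [Ideal.span_le, Set.singleton_subset_iff]
      exact hmem
    have hne : Ideal.span {(ℓ : 𝓞 K)} ≠ ⊥ := by
      rw [Ne, Ideal.span_singleton_eq_bot]
      exact_mod_cast hℓ0
    exact ((hℓ.isMaximal hne).eq_of_le hQp.ne_top hle).symm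
  calc ((Ideal.span {(ℓ : ℤ)}).primesOver (𝓞 K)).ncard
      ≤ ({Ideal.span {(ℓ : 𝓞 K)}} : Set (Ideal (𝓞 K))).ncard :=
        Set.ncard_le_ncard hsub (Set.finite_singleton _)
    _ = 1 := Set.ncard_singleton _

/-- **`2` split in `K` ⇒ `(2)` is not a prime of `𝓞_K`** (two primes over `2ℤ` versus at most one).
`SatisfiesHeegnerHypothesis 2 K` is the tree's spelling of «`2` splits in `K`» and is what the J08 roads get from
Bump–Friedberg–Hoffstein (`hBFH W hw {2} 4`). [folklore] -/
theorem not_isPrime_span_two_of_heegnerHypothesis_two (h2K : SatisfiesHeegnerHypothesis 2 K) :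
    ¬ (Ideal.span {(2 : 𝓞 K)}).IsPrime := by
  intro h2
  have htwo : ((Ideal.span {((2 : ℕ) : ℤ)}).primesOver (𝓞 K)).ncard = 2 := h2K 2 Nat.prime_two (dvd_refl 2)
  have hle : ((Ideal.span {((2 : ℕ) : ℤ)}).primesOver (𝓞 K)).ncard ≤ 1 :=
    ncard_primesOver_le_one_of_isPrime_span (K := K) (ℓ := 2) (by exact_mod_cast h2) two_ne_zero
  omega

/-- **`2` split in `K` ⇒ `2` is not a Zhang–Kolyvagin prime** (a Kolyvagin prime is inert). [cite: WZhang2014, Notations (xii)] -/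
theorem not_isKolyvaginPrime_two_of_heegnerHypothesis_two (h2K : SatisfiesHeegnerHypothesis 2 K) :
    ¬ Zhang2014.IsKolyvaginPrime N W K p 2 := fun h ↦
  not_isPrime_span_two_of_heegnerHypothesis_two h2K (by exact_mod_cast h.2.2.2.2.1)

/-- **The swap guard `G := (· ≠ 2)` is free in a Heegner field in which `2` splits** — the field of the K9/KT J08
roads. = `hG` of p556091 for that guard, ALL `p` (in particular the K9 face `p = 3`). [cite: WZhang2014, Notations (xii)] -/
theorem swapGuard_of_heegnerHypothesis_two (h2K : SatisfiesHeegnerHypothesis 2 K) :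
    ∀ ℓ : ℕ, Zhang2014.IsKolyvaginPrime N W K p ℓ → ℓ ≠ 2 := by
  rintro ℓ hℓ rfl
  exact not_isKolyvaginPrime_two_of_heegnerHypothesis_two h2K hℓ

/-- **The WIDENED guard `G := (· ≠ 2 ∨ ρ̄_p onto)`** (§2) from the single row condition «`2` Zhang–Kolyvagin for
`(E, K, p)` ⇒ `ρ̄_{E,p}` onto» — the honest residue of the swap on the K9 face. [cite: GrossLMS1991, §2, §3 (3.3)] -/
theorem swapGuardOnto_of (h : Zhang2014.IsKolyvaginPrime N W K p 2 → W.HasSurjectiveModNGaloisRep p) :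
    ∀ ℓ : ℕ, Zhang2014.IsKolyvaginPrime N W K p ℓ → (ℓ ≠ 2 ∨ W.HasSurjectiveModNGaloisRep p) := by
  intro ℓ hℓ
  by_cases hℓ2 : ℓ = 2
  · subst hℓ2; exact Or.inr (h hℓ)
  · exact Or.inl hℓ2

/-- The widened guard for free when `p ≠ 3`. [cite: GrossLMS1991, §3 (3.3)] -/
theorem swapGuardOnto_of_ne_three [Fact p.Prime] (hp3 : p ≠ 3) :
    ∀ ℓ : ℕ, Zhang2014.IsKolyvaginPrime N W K p ℓ → (ℓ ≠ 2 ∨ W.HasSurjectiveModNGaloisRep p) :=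
  fun ℓ hℓ ↦ Or.inl (swapGuard_of_ne_three hp3 ℓ hℓ)

/-- The widened guard for free when `2` splits in `K`. [cite: WZhang2014, Notations (xii)] -/
theorem swapGuardOnto_of_heegnerHypothesis_two (h2K : SatisfiesHeegnerHypothesis 2 K) :
    ∀ ℓ : ℕ, Zhang2014.IsKolyvaginPrime N W K p ℓ → (ℓ ≠ 2 ∨ W.HasSurjectiveModNGaloisRep p) :=
  fun ℓ hℓ ↦ Or.inl (swapGuard_of_heegnerHypothesis_two h2K ℓ hℓ)

/-- The widened guard for free on a row with `ρ̄_{E,p}` onto (the 9-deficient rows of the U₀-ns node).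
[cite: GrossLMS1991, §2] -/
theorem swapGuardOnto_of_surjective (hsurj : W.HasSurjectiveModNGaloisRep p) :
    ∀ ℓ : ℕ, Zhang2014.IsKolyvaginPrime N W K p ℓ → (ℓ ≠ 2 ∨ W.HasSurjectiveModNGaloisRep p) :=
  fun _ _ ↦ Or.inr hsurj

end Guard

/-! ## §2 The S5 reading with the widened guard, from Gross 1991 Prop. 3.7 (2) -/

/-- **S5 (primed, (B)-only) with guard `l ≠ 2 ∨ ρ̄_{E,p} onto`, from Gross 1991 Prop. 3.7 (2).** = k8t-c4 g11's
`JetchevIrreducibleProp44.h47P2_of_prop37_2` (p541604) with the binder `l ≠ 2` replaced by `l ≠ 2 ∨ W.HasSurjectiveModNGaloisRep p`;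
at `l = 2` the fact's SECOND disjunct is fed (`¬CM`, `p` odd, `ρ̄_p` onto, every prime of `m·l` Gross–Kolyvagin by
`JET.ZhangGross.forall_isKolyvaginPrime_of_zhang`); the registered `ℓ ≠ 2` form is recovered by `Or.inl`. CONDITIONAL on the named fact.
[cite: GrossLMS1991, Prop. 3.7 (2), §2, §3 (3.1)–(3.3)] [cite: McCallumLMS1991, §4 Prop. 4.4] [cite: Jetchev2008, Prop. 4.7, Rem. 6.2] -/
theorem h47PG_of_prop37_2 (h37 : GrossLMS1991.prop37_2_frobeniusCongruence) :
    ∀ (W : WeierstrassCurve ℚ) [W.IsElliptic] [W.IsGloballyMinimal] [NeZero (W.conductorNorm ℤ)],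
        ¬ W.HasCM →
        ∀ (K : Type) [Field K] [NumberField K], IsImaginaryQuadratic K →
        NumberField.discr K ≠ -3 → NumberField.discr K ≠ -4 →
        SatisfiesHeegnerHypothesis (W.conductorNorm ℤ) K →
        ∀ (p : ℕ) [Fact p.Prime], p ≠ 2 → W.HasIrreducibleModPGaloisRep p → (p : ℤ) ∣ W.conductorNorm ℤ →
        ∀ (Dt : ModularParametrizationData W (W.conductorNorm ℤ)) (β : ℤ) (ι : K →+* ℂ)
          (M : ℕ), 1 ≤ M →
        ∀ (m l : ℕ), Squarefree (m * l) → l.Prime → (l ≠ 2 ∨ W.HasSurjectiveModNGaloisRep p) → ¬ l ∣ m →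
          (∀ l' ∈ (m * l).primeFactors, Zhang2014.IsKolyvaginPrime (W.conductorNorm ℤ) W K p l' ∧
            M ≤ Zhang2014.kolyvaginIndex W p l') →
        ∀ (d : KolyvaginHeegnerData Dt β ι m) (d' : KolyvaginHeegnerData Dt β ι (m * l)),
          (∀ l' ∈ m.primeFactors, ∀ (x : ringClassField K ι m) (x' : ringClassField K ι (m * l)),
            (x : ℂ) = x' → ((d'.σ l' x' : ringClassField K ι (m * l)) : ℂ) = (d.σ l' x : ℂ)) →
          (∀ s ∈ d.S, ∃ s' ∈ d'.S, ∀ (x : ringClassField K ι m) (x' : ringClassField K ι (m * l)),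
            (x : ℂ) = x' → ((s' x' : ringClassField K ι (m * l)) : ℂ) = (s x : ℂ)) →
          (∀ s' ∈ d'.S, ∃ s ∈ d.S, ∀ (x : ringClassField K ι m) (x' : ringClassField K ι (m * l)),
            (x : ℂ) = x' → ((s' x' : ringClassField K ι (m * l)) : ℂ) = (s x : ℂ)) →
          (∀ (x : ringClassField K ι m) (x' : ringClassField K ι (m * l)),
            (x : ℂ) = x' → d'.emb x' = d.emb x) →
        ∀ (v : HeightOneSpectrum (𝓞 K)), (l : 𝓞 K) ∈ v.asIdeal →
        ∀ (j : ℕ),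
          (((p ^ j : ℕ) : ℤ) • d'.kolyvaginClass (Fact.out : p.Prime) M ∈
              (W.baseChange K).torsionLocalKer (v.adicCompletion K) ((p ^ M : ℕ) : ℤ) ↔
            ((p ^ j : ℕ) : ℤ) • d.kolyvaginClass (Fact.out : p.Prime) M ∈
              (W.baseChange K).torsionLocalKer (v.adicCompletion K) ((p ^ M : ℕ) : ℤ)) := by
  intro W _ _ _ hcm K _ _ hK hD3 hD4 hH p _ hp2 hirr hpN Dt β ι M hM m l hml hl hl2 hlm hK' d d' hσ hS hS' hemb v hv j
  have hp : p.Prime := Fact.out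
  have hn0 : m * l ≠ 0 := hml.ne_zero
  have hln : l ∈ (m * l).primeFactors := Nat.mem_primeFactors.mpr ⟨hl, dvd_mul_left l m, hn0⟩
  have hml' : m * l / l = m := Nat.mul_div_cancel m hl.pos
  have hpN' : p ∣ W.conductorNorm ℤ := Int.natCast_dvd_natCast.mp hpN
  have hD : NumberField.discr K < -4 := KolyvaginAssembly.discr_lt_neg_four hK ⟨hD3, hD4⟩
  have hcop : Nat.Coprime (m * l) (W.conductorNorm ℤ) :=
    (KolyvaginH37Bridge.coprime_of_forall_not_dvd hn0 fun q hq ↦ (hK' q hq).1.2.1).symm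
  have hinert : (Ideal.span {(l : 𝓞 K)}).IsPrime := (hK' l hln).1.2.2.2.2.1
  haveI : ∀ k : ℕ, NumberField (ringClassField K ι k) := fun k ↦
    Summit.BirchSwinnertonDyer.Rank1Residual.JET.numberField_ringClassField K hK ι k
  -- the fact's `ℓ`-binder: `l ≠ 2`, or Gross's §2 disjunct on a row with surjective mod-`p` image
  have hl2' : l ≠ 2 ∨ (¬ W.HasCM ∧ ∃ p : ℕ, p.Prime ∧ p ≠ 2 ∧ W.HasSurjectiveModNGaloisRep p ∧
      ∀ q ∈ (m * l).primeFactors,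
        Literature.NumberTheory.EllipticCurves.IsKolyvaginPrime (W.conductorNorm ℤ) W K p q) :=
    hl2.imp id fun hsurj ↦ ⟨hcm, p, hp, hp2, hsurj,
      ZhangGross.forall_isKolyvaginPrime_of_zhang W K hK hp2 hsurj fun q hq ↦ (hK' q hq).1⟩
  -- standing inputs of the two classes (irreducibility + `p` unramified in `K`; KolyCert)
  obtain ⟨hA', hPt'⟩ := JetchevIrreducibleProp44.isAdmissible_and_mem_invPoints_of_irreducible_of_heegner hK ι W
    hD3 hD4 hH hp2 hirr hpN' Dt β hml hK' d'
  have hKm : ∀ q ∈ m.primeFactors, Zhang2014.IsKolyvaginPrime (W.conductorNorm ℤ) W K p q ∧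
      M ≤ Zhang2014.kolyvaginIndex W p q :=
    fun q hq ↦ hK' q (Nat.primeFactors_mono (dvd_mul_right m l) hn0 hq)
  obtain ⟨hA, hPt⟩ := JetchevIrreducibleProp44.isAdmissible_and_mem_invPoints_of_irreducible_of_heegner hK ι W
    hD3 hD4 hH hp2 hirr hpN' Dt β (hml.squarefree_of_dvd (dvd_mul_right m l)) hKm d
  -- (γ) at the pair, from the published fact
  have hγ : ∀ [Fact l.Prime] (hΔ : ¬ (l : ℤ) ∣ minimalDiscriminantInt W)
      (φ₀ : absoluteGaloisGroup (ZMod l)), (∀ x : AlgebraicClosure (ZMod l), φ₀ • x = x ^ l) →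
      ∀ (hle : ringClassField K ι m ≤ ringClassField K ι (m * l))
        (γ : ringClassField K ι (m * l) ≃ₐ[ℚ] ringClassField K ι (m * l)), γ ∈ ringClassGal ι (m * l) →
        geomReduction hΔ ((RatClosure.pointsEquiv (K := K) W).symm
            (d'.toGeomPoints (pointGalHom W (ringClassField K ι (m * l)) γ d'.y))) =
          φ₀ • geomReduction hΔ ((RatClosure.pointsEquiv (K := K) W).symm
            (d'.toGeomPoints (pointGalHom W (ringClassField K ι (m * l)) γ
              (WeierstrassCurve.Affine.Point.map (W' := W)
                (letI : Algebra K ℂ := ι.toAlgebra; (RingClassField.inclusion ι hle).restrictScalars ℚ)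
                d.y)))) := by
    -- transport the fact's corollary (data at `mℓ / ℓ`) to data at `m`
    have key : ∀ (m₀ : ℕ) (e : m * l / l = m₀) (d₀ : KolyvaginHeegnerData Dt β ι m₀) [Fact l.Prime]
        (hΔ : ¬ (l : ℤ) ∣ minimalDiscriminantInt W)
        (φ₀ : absoluteGaloisGroup (ZMod l)), (∀ x : AlgebraicClosure (ZMod l), φ₀ • x = x ^ l) →
        ∀ (hle : ringClassField K ι m₀ ≤ ringClassField K ι (m * l))
          (γ : ringClassField K ι (m * l) ≃ₐ[ℚ] ringClassField K ι (m * l)),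
          geomReduction hΔ ((RatClosure.pointsEquiv (K := K) W).symm
              (d'.toGeomPoints (pointGalHom W (ringClassField K ι (m * l)) γ d'.y))) =
            φ₀ • geomReduction hΔ ((RatClosure.pointsEquiv (K := K) W).symm
              (d'.toGeomPoints (pointGalHom W (ringClassField K ι (m * l)) γ
                (WeierstrassCurve.Affine.Point.map (W' := W)
                  (letI : Algebra K ℂ := ι.toAlgebra; (RingClassField.inclusion ι hle).restrictScalars ℚ)
                  d₀.y)))) := by
      intro m₀ e
      subst e
      intro d₀ _ hΔ φ₀ hφ₀ hle γ
      exact h37.reductionCongruence rfl hK ⟨hD3, hD4⟩ hH hml hcop hln hl2' hinert d' d₀ hΔ hφ₀ hle γ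
    intro _ hΔ φ₀ hφ₀ hle γ _
    exact key m hml' d hΔ φ₀ hφ₀ hle γ
  -- the pair END (corner-p1 g10): `Sel_λ` for `c(d')` ↔ `Ker_λ` for `c(d)`
  have hpair := Prop44.zsmul_kolyvaginClass_mem_selmerLocalKer_iff_of_compat hK ι hD hH Dt hp hp2 hM hml hK' hln
    hml' d' d hσ hS hS' hemb hγ hA' hA hPt' hPt v hv j
  -- the (A)-half at the top
  have hAtop := JetchevIrreducibleProp44.zsmul_kolyvaginClass_mem_selmerLocalKer_iff_mem_torsionLocalKer_of_irreducible_of_heegner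
    hK ι W hD3 hD4 hH hp2 hirr hpN' Dt β hml hln hK' d' v hv ((p : ℤ) ^ j)
  rw [show ((p ^ j : ℕ) : ℤ) = (p : ℤ) ^ j from Nat.cast_pow p j]
  exact hAtop.symm.trans hpair

/-! ## §3 The row form with the widened guard (the `h47row` of the swap walk, `G := (· ≠ 2 ∨ ρ̄_p onto)`) -/

/-- **McCallum Prop. 4.4 as the ROW binder `h47row` of `JetchevIrreducibleSwap.exists_conductor_levelIndex_ge_of_minDepth_of_irreducible`
with guard `G := fun l ↦ l ≠ 2 ∨ W.HasSurjectiveModNGaloisRep p`**, on a row `E[p]` irreducible, `p ∣ N_E`, from the widened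
reading of §2 (hence from Gross 1991 Prop. 3.7 (2)). Proof = k8t-c4 g11's adapter
`JetchevIrreducibleH63P2.addOrderOf_localization_kolyvaginClass_mul_eq_of_prop47IrredP2` byte-for-byte with the guard widened.
CONDITIONAL on the displayed reading. [cite: McCallumLMS1991, §4 Prop. 4.4 (p. 301)] [cite: Jetchev2008, Prop. 4.7] -/
theorem addOrderOf_localization_kolyvaginClass_eq_of_h47PG
    (h47PG : ∀ (W : WeierstrassCurve ℚ) [W.IsElliptic] [W.IsGloballyMinimal] [NeZero (W.conductorNorm ℤ)],
        ¬ W.HasCM →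
        ∀ (K : Type) [Field K] [NumberField K], IsImaginaryQuadratic K →
        NumberField.discr K ≠ -3 → NumberField.discr K ≠ -4 →
        SatisfiesHeegnerHypothesis (W.conductorNorm ℤ) K →
        ∀ (p : ℕ) [Fact p.Prime], p ≠ 2 → W.HasIrreducibleModPGaloisRep p → (p : ℤ) ∣ W.conductorNorm ℤ →
        ∀ (Dt : ModularParametrizationData W (W.conductorNorm ℤ)) (β : ℤ) (ι : K →+* ℂ)
          (M : ℕ), 1 ≤ M →
        ∀ (m l : ℕ), Squarefree (m * l) → l.Prime → (l ≠ 2 ∨ W.HasSurjectiveModNGaloisRep p) → ¬ l ∣ m →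
          (∀ l' ∈ (m * l).primeFactors, Zhang2014.IsKolyvaginPrime (W.conductorNorm ℤ) W K p l' ∧
            M ≤ Zhang2014.kolyvaginIndex W p l') →
        ∀ (d : KolyvaginHeegnerData Dt β ι m) (d' : KolyvaginHeegnerData Dt β ι (m * l)),
          (∀ l' ∈ m.primeFactors, ∀ (x : ringClassField K ι m) (x' : ringClassField K ι (m * l)),
            (x : ℂ) = x' → ((d'.σ l' x' : ringClassField K ι (m * l)) : ℂ) = (d.σ l' x : ℂ)) →
          (∀ s ∈ d.S, ∃ s' ∈ d'.S, ∀ (x : ringClassField K ι m) (x' : ringClassField K ι (m * l)),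
            (x : ℂ) = x' → ((s' x' : ringClassField K ι (m * l)) : ℂ) = (s x : ℂ)) →
          (∀ s' ∈ d'.S, ∃ s ∈ d.S, ∀ (x : ringClassField K ι m) (x' : ringClassField K ι (m * l)),
            (x : ℂ) = x' → ((s' x' : ringClassField K ι (m * l)) : ℂ) = (s x : ℂ)) →
          (∀ (x : ringClassField K ι m) (x' : ringClassField K ι (m * l)),
            (x : ℂ) = x' → d'.emb x' = d.emb x) →
        ∀ (v : HeightOneSpectrum (𝓞 K)), (l : 𝓞 K) ∈ v.asIdeal →
        ∀ (j : ℕ),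
          (((p ^ j : ℕ) : ℤ) • d'.kolyvaginClass (Fact.out : p.Prime) M ∈
              (W.baseChange K).torsionLocalKer (v.adicCompletion K) ((p ^ M : ℕ) : ℤ) ↔
            ((p ^ j : ℕ) : ℤ) • d.kolyvaginClass (Fact.out : p.Prime) M ∈
              (W.baseChange K).torsionLocalKer (v.adicCompletion K) ((p ^ M : ℕ) : ℤ)))
    (W : WeierstrassCurve ℚ) [W.IsElliptic] [W.IsGloballyMinimal] [NeZero (W.conductorNorm ℤ)]
    (hcm : ¬ W.HasCM) (K : Type) [Field K] [NumberField K] (hK : IsImaginaryQuadratic K)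
    (hD3 : NumberField.discr K ≠ -3) (hD4 : NumberField.discr K ≠ -4)
    (hH : SatisfiesHeegnerHypothesis (W.conductorNorm ℤ) K)
    (p : ℕ) [Fact p.Prime] (hp2 : p ≠ 2) (hirr : W.HasIrreducibleModPGaloisRep p)
    (hpN : p ∣ W.conductorNorm ℤ)
    (Dt : ModularParametrizationData W (W.conductorNorm ℤ)) (β : ℤ) (ι : K →+* ℂ) :
    ∀ (M : ℕ), 1 ≤ M → ∀ (m l : ℕ), Squarefree (m * l) → l.Prime → (l ≠ 2 ∨ W.HasSurjectiveModNGaloisRep p) →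
      ¬ l ∣ m →
      (∀ l' ∈ (m * l).primeFactors, Zhang2014.IsKolyvaginPrime (W.conductorNorm ℤ) W K p l' ∧
        M ≤ Zhang2014.kolyvaginIndex W p l') →
      ∀ (d : KolyvaginHeegnerData Dt β ι m) (d' : KolyvaginHeegnerData Dt β ι (m * l)),
      (∀ l' ∈ m.primeFactors, ∀ (x : ringClassField K ι m) (x' : ringClassField K ι (m * l)),
        (x : ℂ) = x' → ((d'.σ l' x' : ringClassField K ι (m * l)) : ℂ) = (d.σ l' x : ℂ)) →
      (∀ s ∈ d.S, ∃ s' ∈ d'.S, ∀ (x : ringClassField K ι m) (x' : ringClassField K ι (m * l)),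
        (x : ℂ) = x' → ((s' x' : ringClassField K ι (m * l)) : ℂ) = (s x : ℂ)) →
      (∀ s' ∈ d'.S, ∃ s ∈ d.S, ∀ (x : ringClassField K ι m) (x' : ringClassField K ι (m * l)),
        (x : ℂ) = x' → ((s' x' : ringClassField K ι (m * l)) : ℂ) = (s x : ℂ)) →
      (∀ (x : ringClassField K ι m) (x' : ringClassField K ι (m * l)),
        (x : ℂ) = x' → d'.emb x' = d.emb x) →
      ∀ (v : HeightOneSpectrum (𝓞 K)), (l : 𝓞 K) ∈ v.asIdeal →
      addOrderOf ((galoisCohomology.localization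
          ((W.baseChange K).torsionGaloisModule ((p ^ M : ℕ) : ℤ)) (Sum.inr v) 1 :
            galH1Torsion (W.baseChange K) ((p ^ M : ℕ) : ℤ) →+ _)
          (d'.kolyvaginClass (Fact.out : p.Prime) M)) =
        addOrderOf ((galoisCohomology.localization
          ((W.baseChange K).torsionGaloisModule ((p ^ M : ℕ) : ℤ)) (Sum.inr v) 1 :
            galH1Torsion (W.baseChange K) ((p ^ M : ℕ) : ℤ) →+ _)
          (d.kolyvaginClass (Fact.out : p.Prime) M)) := by
  intro M hM m l hml hl hl2 hlm hK' d d' hσ hS hS' hemb v hv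
  have hp : p.Prime := Fact.out
  set loc : galH1Torsion (W.baseChange K) ((p ^ M : ℕ) : ℤ) →+
      galoisCohomology (((W.baseChange K).torsionGaloisModule ((p ^ M : ℕ) : ℤ)).toLocal (Sum.inr v)) 1 :=
    galoisCohomology.localization ((W.baseChange K).torsionGaloisModule ((p ^ M : ℕ) : ℤ)) (Sum.inr v) 1
    with hlocdef
  have hloc : ∀ (z : galH1Torsion (W.baseChange K) ((p ^ M : ℕ) : ℤ)) (j : ℕ), loc (p ^ j • z) = 0 ↔
      ((p ^ j : ℕ) : ℤ) • z ∈ (W.baseChange K).torsionLocalKer (v.adicCompletion K) ((p ^ M : ℕ) : ℤ) := by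
    intro z j
    haveI : CharZero (v.adicCompletion K) := charZero_of_injective_algebraMap (algebraMap K _).injective
    rw [hlocdef, natCast_zsmul, mem_torsionLocalKer_iff_res_eq_zero (W := W.baseChange K)
      (E := v.adicCompletion K) (pow_ne_zero M hp.ne_zero)]
    exact Iff.rfl
  have hkillL : ∀ z : galH1Torsion (W.baseChange K) ((p ^ M : ℕ) : ℤ), p ^ M • loc z = 0 := fun z ↦
    galoisCohomology.nsmul_eq_zero_of_forall
      (((W.baseChange K).torsionGaloisModule ((p ^ M : ℕ) : ℤ)).toLocal (Sum.inr v))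
      (fun T ↦ by
        have h := (W.baseChange K).natAbs_nsmul_geomTorsion T
        rwa [Int.natAbs_natCast] at h) (loc z)
  have h := h47PG W hcm K hK hD3 hD4 hH p hp2 hirr (Int.natCast_dvd_natCast.mpr hpN) Dt β ι M hM m l hml hl hl2 hlm
    hK' d d' hσ hS hS' hemb v hv
  refine addOrderOf_eq_addOrderOf_of_forall_nsmul_eq_zero_iff hp (hkillL _) (hkillL _) fun j ↦ ?_
  rw [← map_nsmul, ← map_nsmul]
  exact (hloc _ j).trans ((h j).trans (hloc _ j).symm)

end Summit.BirchSwinnertonDyer.BirchSwinnertonDyer.Theorems.JetchevIrreducibleSwapAtP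

end
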